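import Summits.Parity.BatemanHorn.Theorems.AlmostPrimeZerosDiscMajorantLogFixedDiscX
import HarnessLib

/-!
# Crux `DiscMajorantLog` (stmt-Parity-17114), line `Sketch`, stub `stub_growingDiscXOfParts` (E4)

Support lemma for the crux `Summit.Parity.BatemanHorn.Theses.AlmostPrimeZeros.DiscMajorantLog`
(line `Sketch`), calibration wave 3: the cell `k = 1`, `f = X` of the crux on the GROWING disc
`‖z − 1‖ ≤ 3 log log x` with the Γ-budget `e^{C‖z−1‖ log(‖z−1‖+2)}`, ASSEMBLED from its four parts
taken as hypotheses — (E1) capped Euler data on `σ > 1 − 1/(4(R+1))` with budget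
`e^{b(1+R)log(R+2)}`, (E2b) the one-sided Selberg–Delange engine for a difference of Riesz means in
the range `R ≤ 4 log log x`, (E3) the de-smoothing `Σ_{x<n≤x+h} R^{s(n)} ≤ x (log x)^{−R−1}` with
`h = x e^{−(log log x)³}`, and the Rankin majorant.  The assembly is the one of
`LinearCappedRepulsion.JensenStieltjesMajorant.tiltedMajorant_of_parts`
[MontgomeryVaughan2007, §7.4, Theorems 7.17–7.18]: `R := 1 + ‖z − 1‖ ≤ 4 log log x`,
`A(x)·h = (A₁(x+h) − A₁(x)) − Σ_{x<n≤x+h} z^{s(n)}(x + h − n)`, `P_x(z) = 1 + A(x)`,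
`(log x)^{−R−1} ≤ (log x)^{Re z−1}`, `x (log x)^{Re z−1} ≥ 1` (as `e^ℓ ≥ 3ℓ²` for
`ℓ = log log x ≥ 9`), and the elementary budget shift `(2+r)log(r+3) ≤ 3 r log(r+2) + 3`; the
exponent of `f = (X)` is `s(n)` by the landed `FixedDiscX.exponent_X`.
-/

noncomputable section

namespace Summit.Parity.BatemanHorn.Cruxes.DiscMajorantLog.Sketch

open Polynomial
open scoped BigOperators
open Literature.NumberTheory.LFunctions

namespace GrowingDiscX

/-- The budget shift from the engine's shape to the crux's shape: for `r ≥ 0`,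
`(2 + r) log(r + 3) ≤ 3 r log(r + 2) + 3` (from `log(r+3) ≤ log(r+2) + 1/(r+2)` and
`log(r+2) ≤ r + 1`). [folklore] -/
theorem budget_shift {r : ℝ} (hr : 0 ≤ r) :
    (2 + r) * Real.log (r + 3) ≤ 3 * r * Real.log (r + 2) + 3 := by
  have h2 : 0 < r + 2 := by linarith
  have hL0 : 0 ≤ Real.log (r + 2) := Real.log_nonneg (by linarith)
  have hL1 : Real.log (r + 2) ≤ r + 1 := by
    have := Real.log_le_sub_one_of_pos h2; linarith
  have h32 : Real.log (r + 3) ≤ Real.log (r + 2) + 1 / (r + 2) := by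
    have hq : Real.log ((r + 3) / (r + 2)) ≤ (r + 3) / (r + 2) - 1 :=
      Real.log_le_sub_one_of_pos (by positivity)
    rw [Real.log_div (by linarith) (by linarith)] at hq
    have : (r + 3) / (r + 2) - 1 = 1 / (r + 2) := by field_simp; ring
    linarith
  have h3 : (2 + r) * Real.log (r + 3) ≤ (2 + r) * Real.log (r + 2) + 1 := by
    have h31 := mul_le_mul_of_nonneg_left h32 (by linarith : (0 : ℝ) ≤ 2 + r)
    have e : (2 + r) * (1 / (r + 2)) = 1 := by field_simp; ring
    linarith [h31, e]
  nlinarith [mul_nonneg hL0 (by linarith : (0 : ℝ) ≤ r - Real.log (r + 2) + 1),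
    sq_nonneg (1 - Real.log (r + 2)), mul_nonneg hr hL0]

/-- `3 ℓ² ≤ e^ℓ` for `ℓ ≥ 9` (from `ℓ⁴/4! ≤ e^ℓ`). [folklore] -/
theorem three_sq_le_exp {ℓ : ℝ} (hℓ : 9 ≤ ℓ) : 3 * ℓ ^ 2 ≤ Real.exp ℓ := by
  have h := Real.pow_div_factorial_le_exp ℓ (by linarith) 4
  have h4 : ((Nat.factorial 4 : ℕ) : ℝ) = 24 := by norm_num [Nat.factorial]
  rw [h4] at h
  have h72 : 72 ≤ ℓ ^ 2 := by nlinarith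
  have : 3 * ℓ ^ 2 ≤ ℓ ^ 4 / 24 := by
    rw [le_div_iff₀ (by norm_num)]
    have e : ℓ ^ 4 = ℓ ^ 2 * ℓ ^ 2 := by ring
    rw [e]
    nlinarith
  linarith

/-- The final real-number assembly: from `1 ≤ Q`, `1 ≤ E ≤ e^K` conclude
`1 + Q (E + 1) ≤ 3 e^K Q`. [folklore] -/
theorem one_add_le_three_mul_exp {Q E K : ℝ} (hQ : 1 ≤ Q) (hE : 1 ≤ E) (hK : E ≤ Real.exp K) :
    1 + Q * (E + 1) ≤ 3 * Real.exp K * Q := by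
  have hQ0 : 0 ≤ Q := by linarith
  have h1 : Q ≤ Q * E := by simpa using mul_le_mul_of_nonneg_left hE hQ0
  have h2 : Q * E ≤ Q * Real.exp K := mul_le_mul_of_nonneg_left hK hQ0
  nlinarith

end GrowingDiscX

open GrowingDiscX in
/-- **Stub E4 (assembly of the cell `k = 1`, `f = X` on the growing disc, conditional on E1, E2b,
E3 and the Rankin majorant).**  As `tiltedMajorant_of_parts`: `R := 1 + ‖z − 1‖ ≤ 4 log log x`,
`h := x e^{−(log log x)³}`, `A(x)·h = (A₁(x+h) − A₁(x)) − Σ_{x<n≤x+h} z^{s(n)}(x+h−n)`,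
`P_x(z) = 1 + A(x)`, `(log x)^{−R−1} ≤ (log x)^{Re z − 1}`, `x (log x)^{Re z−1} ≥ 1`, and
`(2+r)log(r+3) ≤ 3 r log(r+2) + 3` to reach the crux's budget shape; the exponent of `f = (X)` is
`s(n)` (`FixedDiscX.exponent_X`).  Constants: `A = 3 e^{3(b+c)}`, `C = 3(b+c)`,
`x₀ = max (max x₁ ⌈X₀⌉₊) ⌈exp (exp 9)⌉₊`.
[cite: MontgomeryVaughan2007, §7.4 Theorems 7.17–7.18] -/
theorem stub_growingDiscXOfParts :
    (∃ b : ℝ, 0 ≤ b ∧ ∀ R : ℝ, 0 ≤ R → ∀ z : ℂ, ‖z‖ ≤ R → ∃ G : ℂ → ℂ,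
      Literature.NumberTheory.LFunctions.SelbergDelange.RieszData R (1 - 1 / (4 * (R + 1)))
        (Real.exp (b * (1 + R) * Real.log (R + 2))) z
        (fun n : ℕ => z ^ (n.factorization.sum fun _ v => min v 2)) G) →
    (∃ X₀ : ℝ, ∃ c : ℝ, 0 ≤ c ∧ ∀ (R B : ℝ) (z : ℂ) (a : ℕ → ℂ) (G : ℂ → ℂ), 1 ≤ R →
      Literature.NumberTheory.LFunctions.SelbergDelange.RieszData R (1 - 1 / (4 * (R + 1))) B z a G →
      ∀ x h : ℝ, X₀ ≤ x → R ≤ 4 * Real.log (Real.log x) →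
        x * Real.exp (-(Real.log (Real.log x) ^ 3)) ≤ h → h ≤ x →
        ‖(∑ n ∈ Finset.Ioc 0 ⌊x + h⌋₊, a n * (((x + h : ℝ) : ℂ) - n)) -
            ∑ n ∈ Finset.Ioc 0 ⌊x⌋₊, a n * ((x : ℂ) - n)‖ ≤
          h * x * Real.log x ^ (z.re - 1) * B * Real.exp (c * (1 + R) * Real.log (R + 2))) →
    (∀ B : ℝ, 0 ≤ B →
      (∀ x : ℕ, 3 ≤ x → ∀ y : ℝ, 1 ≤ y →
        ∑ n ∈ Finset.range (x + 1), y ^ (n.factorization.sum fun _ v => min v 2) ≤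
          ((x : ℝ) + 1) * Real.exp (B * y * Real.log (Real.log x) + B * y ^ (3 / 2 : ℝ))) →
      ∃ x₁ : ℕ, ∀ x : ℕ, x₁ ≤ x → ∀ R : ℝ, 1 ≤ R → R ≤ 4 * Real.log (Real.log x) →
        ∑ n ∈ Finset.Ioc x ⌊(x : ℝ) + x * Real.exp (-(Real.log (Real.log x) ^ 3))⌋₊,
            R ^ (n.factorization.sum fun _ v => min v 2) ≤
          (x : ℝ) * Real.log x ^ (-R - 1)) →
    (∃ B : ℝ, 0 ≤ B ∧ ∀ x : ℕ, 3 ≤ x → ∀ y : ℝ, 1 ≤ y →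
        ∑ n ∈ Finset.range (x + 1), y ^ (n.factorization.sum fun _ v => min v 2) ≤
          ((x : ℝ) + 1) * Real.exp (B * y * Real.log (Real.log x) + B * y ^ (3 / 2 : ℝ))) →
    ∃ A C : ℝ, ∃ x₀ : ℕ, ∀ x : ℕ, x₀ ≤ x → ∀ z : ℂ, ‖z - 1‖ ≤ 3 * Real.log (Real.log (x : ℝ)) →
      ‖(∑ n ∈ Finset.range (x + 1), (z : ℂ) ^ (∑ i, ((((![Polynomial.X] : Fin 1 → Polynomial ℤ) i).eval
          (n : ℤ)).toNat.factorization.sum fun _ v => min v 2)))‖ ≤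
        A * (x : ℝ) * (Real.log (x : ℝ)) ^ (((1 : ℕ) : ℝ) * ((z : ℂ).re - 1)) *
          Real.exp (C * ‖(z : ℂ) - 1‖ * Real.log (‖(z : ℂ) - 1‖ + 2)) := by
  intro hEuler hEngine hShort hRankin
  obtain ⟨b, hb0, hEul⟩ := hEuler
  obtain ⟨X₀, c, hc0, hEng⟩ := hEngine
  obtain ⟨Br, hBr0, hrank⟩ := hRankin
  obtain ⟨x₁, hshort⟩ := hShort Br hBr0 hrank
  refine ⟨3 * Real.exp (3 * (b + c)), 3 * (b + c), max (max x₁ ⌈X₀⌉₊) ⌈Real.exp (Real.exp 9)⌉₊,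
    fun x hx z hz => ?_⟩
  simp_rw [FixedDiscX.exponent_X]
  rw [Nat.cast_one, one_mul]
  -- unpacking the threshold
  have hx₁ : x₁ ≤ x := le_trans ((le_max_left _ _).trans (le_max_left _ _)) hx
  have hX₀ : X₀ ≤ (x : ℝ) :=
    (Nat.le_ceil X₀).trans (by exact_mod_cast ((le_max_right _ _).trans (le_max_left _ _)).trans hx)
  have hxexp : Real.exp (Real.exp 9) ≤ (x : ℝ) :=
    (Nat.le_ceil _).trans (by exact_mod_cast (le_max_right _ _).trans hx)
  have hxpos : (0 : ℝ) < x := (Real.exp_pos _).trans_le hxexp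
  have hlogx : Real.exp 9 ≤ Real.log x := (Real.le_log_iff_exp_le hxpos).2 hxexp
  set 𝓛 : ℝ := Real.log x with h𝓛def
  have h𝓛pos : 0 < 𝓛 := (Real.exp_pos _).trans_le hlogx
  set L : ℝ := Real.log 𝓛 with hLdef
  have hL9 : 9 ≤ L := (Real.le_log_iff_exp_le h𝓛pos).2 hlogx
  have hL0 : 0 < L := by linarith
  have h𝓛1 : 1 ≤ 𝓛 := by
    have : (1 : ℝ) ≤ Real.exp 9 := Real.one_le_exp (by norm_num)
    linarith
  -- the radius
  set r : ℝ := ‖z - 1‖ with hrdef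
  have hr0 : 0 ≤ r := norm_nonneg _
  set R : ℝ := 1 + r with hRdef
  have hR1 : 1 ≤ R := by rw [hRdef]; linarith
  have hR0 : 0 ≤ R := by linarith
  have hzR : ‖z‖ ≤ R := by
    have h := norm_add_le (z - 1) 1
    simp only [sub_add_cancel, norm_one] at h
    rw [hRdef, hrdef]; linarith
  have hr3L : r ≤ 3 * L := hz
  have hR4 : R ≤ 4 * L := by rw [hRdef]; linarith
  have hrez' : -r ≤ z.re - 1 := by
    have h1 : |(z - 1).re| ≤ ‖z - 1‖ := Complex.abs_re_le_norm _
    have h2 : (z - 1).re = z.re - 1 := by simp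
    rw [h2] at h1
    rw [hrdef]
    linarith [neg_abs_le (z.re - 1)]
  have hrez : -R ≤ z.re - 1 := by rw [hRdef]; linarith
  -- the data and the engine
  obtain ⟨G, hData⟩ := hEul R hR0 z hzR
  set h : ℝ := (x : ℝ) * Real.exp (-(Real.log (Real.log x) ^ 3)) with hhdef
  have hhpos : 0 < h := mul_pos hxpos (Real.exp_pos _)
  have hhx : h ≤ x := by
    have : Real.exp (-(Real.log (Real.log x) ^ 3)) ≤ 1 := by
      rw [Real.exp_le_one_iff, neg_nonpos]; positivity
    calc h = (x : ℝ) * Real.exp (-(Real.log (Real.log x) ^ 3)) := rfl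
      _ ≤ (x : ℝ) * 1 := by gcongr
      _ = x := mul_one _
  have hEngx := hEng R _ z _ G hR1 hData x h hX₀ hR4 le_rfl hhx
  -- the short sum
  have hShortx := hshort x hx₁ R hR1 hR4
  -- notation for the sums
  set sfun : ℕ → ℕ := fun n => n.factorization.sum fun _ v => min v 2 with hsfun
  set a : ℕ → ℂ := fun n => z ^ sfun n with hadef
  set m : ℕ := ⌊(x : ℝ) + h⌋₊ with hmdef
  have hxm : x ≤ m := by
    rw [hmdef]; exact Nat.le_floor (by linarith)
  have hmxh : (m : ℝ) ≤ x + h := Nat.floor_le (by positivity)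
  have hfloorx : ⌊(x : ℝ)⌋₊ = x := Nat.floor_natCast x
  -- A(x) and the decomposition A₁(x+h) − A₁(x) = h·A(x) + E
  set Ax : ℂ := ∑ n ∈ Finset.Ioc 0 x, a n with hAxdef
  set E : ℂ := ∑ n ∈ Finset.Ioc x m, a n * (((x + h : ℝ) : ℂ) - n) with hEdef
  have hdecomp : (∑ n ∈ Finset.Ioc 0 m, a n * (((x + h : ℝ) : ℂ) - n)) -
      ∑ n ∈ Finset.Ioc 0 ⌊(x : ℝ)⌋₊, a n * (((x : ℝ) : ℂ) - n) = (h : ℂ) * Ax + E := by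
    rw [hfloorx, ← Finset.sum_Ioc_consecutive _ (Nat.zero_le x) hxm, hAxdef, hEdef, Finset.mul_sum,
      add_sub_right_comm, ← Finset.sum_sub_distrib]
    congr 1
    refine Finset.sum_congr rfl fun n _ => ?_
    push_cast
    ring
  -- ‖E‖ ≤ h · Σ_{x<n≤m} R^{s(n)} ≤ h · x · 𝓛^{−R−1}
  have hE : ‖E‖ ≤ h * ((x : ℝ) * 𝓛 ^ (-R - 1)) := by
    have hterm : ∀ n ∈ Finset.Ioc x m, ‖a n * (((x + h : ℝ) : ℂ) - n)‖ ≤ R ^ sfun n * h := by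
      intro n hn
      rw [Finset.mem_Ioc] at hn
      rw [norm_mul, hadef]
      refine mul_le_mul ?_ ?_ (norm_nonneg _) (by positivity)
      · simp only [norm_pow]
        exact pow_le_pow_left₀ (norm_nonneg _) hzR _
      · have hn1 : (x : ℝ) < n := by exact_mod_cast hn.1
        have hn2 : (n : ℝ) ≤ m := by exact_mod_cast hn.2
        have : (((x + h : ℝ) : ℂ) - n) = (((x + h - n : ℝ)) : ℂ) := by push_cast; ring
        rw [this, Complex.norm_real, Real.norm_eq_abs, abs_le]
        constructor <;> linarith
    calc ‖E‖ ≤ ∑ n ∈ Finset.Ioc x m, ‖a n * (((x + h : ℝ) : ℂ) - n)‖ := norm_sum_le _ _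
      _ ≤ ∑ n ∈ Finset.Ioc x m, R ^ sfun n * h := Finset.sum_le_sum hterm
      _ = h * ∑ n ∈ Finset.Ioc x m, R ^ sfun n := by rw [Finset.mul_sum]; simp [mul_comm]
      _ ≤ h * ((x : ℝ) * 𝓛 ^ (-R - 1)) := by
          refine mul_le_mul_of_nonneg_left ?_ hhpos.le
          simpa [hmdef, hhdef, hsfun] using hShortx
  -- the engine bound
  set B : ℝ := Real.exp (b * (1 + R) * Real.log (R + 2)) with hBdef
  have hD : ‖(h : ℂ) * Ax + E‖ ≤
      h * x * 𝓛 ^ (z.re - 1) * B * Real.exp (c * (1 + R) * Real.log (R + 2)) := by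
    rw [← hdecomp]
    simpa [hmdef, hadef, hsfun] using hEngx
  -- hence the bound for A(x)
  have h𝓛mono : 𝓛 ^ (-R - 1) ≤ 𝓛 ^ (z.re - 1) :=
    Real.rpow_le_rpow_of_exponent_le h𝓛1 (by linarith)
  set E₁ : ℝ := B * Real.exp (c * (1 + R) * Real.log (R + 2)) with hE₁def
  have hE₁ : E₁ = Real.exp ((b + c) * ((1 + R) * Real.log (R + 2))) := by
    rw [hE₁def, hBdef, ← Real.exp_add]; ring_nf
  have hE₁1 : 1 ≤ E₁ := by
    rw [hE₁]
    refine Real.one_le_exp (mul_nonneg (by positivity) (mul_nonneg (by linarith) ?_))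
    exact Real.log_nonneg (by linarith)
  have hAx : ‖Ax‖ ≤ (x : ℝ) * 𝓛 ^ (z.re - 1) * (E₁ + 1) := by
    have h1 : ‖(h : ℂ) * Ax‖ = h * ‖Ax‖ := by
      rw [norm_mul, Complex.norm_real, Real.norm_of_nonneg hhpos.le]
    have h2 : ‖(h : ℂ) * Ax‖ ≤ ‖(h : ℂ) * Ax + E‖ + ‖E‖ := by
      have := norm_sub_le ((h : ℂ) * Ax + E) E
      simpa using this
    have h3 : h * ‖Ax‖ ≤ h * ((x : ℝ) * 𝓛 ^ (z.re - 1) * (E₁ + 1)) := by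
      rw [← h1]
      calc ‖(h : ℂ) * Ax‖ ≤ ‖(h : ℂ) * Ax + E‖ + ‖E‖ := h2
        _ ≤ h * x * 𝓛 ^ (z.re - 1) * B * Real.exp (c * (1 + R) * Real.log (R + 2)) +
              h * ((x : ℝ) * 𝓛 ^ (-R - 1)) := add_le_add hD hE
        _ ≤ h * x * 𝓛 ^ (z.re - 1) * B * Real.exp (c * (1 + R) * Real.log (R + 2)) +
              h * ((x : ℝ) * 𝓛 ^ (z.re - 1)) := by gcongr
        _ = h * ((x : ℝ) * 𝓛 ^ (z.re - 1) * (E₁ + 1)) := by rw [hE₁def]; ring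
    exact le_of_mul_le_mul_left h3 hhpos
  -- P_x(z) = 1 + A(x)
  have hrange : Finset.range (x + 1) = insert 0 (Finset.Ioc 0 x) := by
    ext n; simp only [Finset.mem_range, Finset.mem_insert, Finset.mem_Ioc]; omega
  have hP : ∑ n ∈ Finset.range (x + 1), z ^ sfun n = 1 + Ax := by
    rw [hrange, Finset.sum_insert (by simp), hAxdef, hadef]
    simp [hsfun]
  -- sizes: x·𝓛^{Re z − 1} ≥ 1
  have h𝓛eq : 𝓛 = Real.exp L := by rw [hLdef, Real.exp_log h𝓛pos]
  have hxeq : (x : ℝ) = Real.exp 𝓛 := by rw [h𝓛def, Real.exp_log hxpos]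
  have hpow : 𝓛 ^ (z.re - 1) = Real.exp (L * (z.re - 1)) := by
    rw [Real.rpow_def_of_pos h𝓛pos, hLdef]
  have hbig : 1 ≤ (x : ℝ) * 𝓛 ^ (z.re - 1) := by
    -- `x 𝓛^{Re z−1} = exp(e^L + L(Re z − 1)) ≥ exp(e^L − L·r) ≥ exp(e^L − 3L²) ≥ 1`
    rw [hxeq, hpow, ← Real.exp_add, h𝓛eq]
    have h1 : L * (z.re - 1) ≥ -(L * r) := by
      have := mul_le_mul_of_nonneg_left hrez' hL0.le
      linarith
    have h2 : L * r ≤ 3 * L ^ 2 := by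
      have := mul_le_mul_of_nonneg_left hr3L hL0.le
      nlinarith
    have h3 : 3 * L ^ 2 ≤ Real.exp L := three_sq_le_exp hL9
    exact Real.one_le_exp (by linarith)
  -- the budget shift `E₁ ≤ exp((b+c)(3 r log(r+2) + 3))`
  have hbud : E₁ ≤ Real.exp ((b + c) * (3 * r * Real.log (r + 2) + 3)) := by
    rw [hE₁, Real.exp_le_exp]
    refine mul_le_mul_of_nonneg_left ?_ (by positivity)
    have e1 : (1 + R) = 2 + r := by rw [hRdef]; ring
    have e2 : R + 2 = r + 3 := by rw [hRdef]; ring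
    rw [e1, e2]
    exact budget_shift hr0
  -- conclusion
  rw [hP]
  calc ‖1 + Ax‖ ≤ ‖(1 : ℂ)‖ + ‖Ax‖ := norm_add_le _ _
    _ ≤ 1 + (x : ℝ) * 𝓛 ^ (z.re - 1) * (E₁ + 1) := by rw [norm_one]; gcongr
    _ ≤ 3 * Real.exp ((b + c) * (3 * r * Real.log (r + 2) + 3)) * ((x : ℝ) * 𝓛 ^ (z.re - 1)) :=
        one_add_le_three_mul_exp hbig hE₁1 hbud
    _ = 3 * Real.exp (3 * (b + c)) * x * 𝓛 ^ (z.re - 1) *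
          Real.exp (3 * (b + c) * r * Real.log (r + 2)) := by
        have e : (b + c) * (3 * r * Real.log (r + 2) + 3) =
            3 * (b + c) * r * Real.log (r + 2) + 3 * (b + c) := by ring
        rw [e, Real.exp_add]; ring

end Summit.Parity.BatemanHorn.Cruxes.DiscMajorantLog.Sketch

end
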